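import Mathlib
import HarnessLib

/-!
# CM torsion core, helpers 4/8: eigen-data over `𝔽̄_ℓ`

Helper file (4/8) for stub `stub_CMTorsionCoreOf` ((K†), the CM torsion core) of line
`Sketch` (isotypic–Minkowski reduction) of crux U
`Summit.ABC.ABC.Theses.IsogenyGlueCongruence.EllipticGluingPrimeBound` (stmt-ABC-13919); the stub
itself is proved in `…EllipticGluingPrimeBoundStubCMTorsionCoreOf`.

* `eigen_data_of_matrices` (registered sub-goal) — from the matrix identities of helpers 3/8
  (`Φ² = D`, `Φ` non-scalar, `S_σ` commuting with `Φ` and multiplicative,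
  `J_k S_σ = ∑ c̄_{ki} S_σ J_i`, `∑ L_k J_k = 1`, Cartan values `(a + b Φ)^{12}`), over `F = 𝔽̄_ℓ`: an
  eigenbasis `v_±` of `Φ` for `± d` (`d² = D`), the characters `ψ_±` of `ker χ` on the eigenlines
  (non-vanishing, multiplicative, finitely many values, `ψ_±(σ) = (a ± b d)^{12}` on Cartan
  elements), and the coordinates `x`, `y` of `J_k v_+` with `c̄(σ) x = x`,
  `ψ_-(σ) c̄(σ) y = ψ_+(σ) y`, `(x, y) ≠ 0`.

Pure matrix algebra over a field; everything is proved; no `def`, no named fact.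
-/

noncomputable section

-- `Summit.<Summit>.<Problem>` is the mandated summit-side namespace (CONVENTIONS §2); for the
-- single-conjunct summit `ABC` the two coincide, so the duplicate `ABC.ABC` is deliberate.
set_option linter.dupNamespace false

namespace Summit.ABC.ABC.Theorems.IsotypicMinkowski

open scoped AddSubgroup Matrix

/-! ## Eigen-data over `𝔽̄_ℓ` (registered sub-goal of the stub) -/


/-- **Eigen-data over `𝔽̄_ℓ`.** From the matrix identities of `matrices_of_module`: over `F = 𝔽̄_ℓ`
the non-scalar `Φ` (`Φ² = D ≠ 0`, `ℓ` odd) has an eigenbasis `v_±` for `± d`, `d² = D`; the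
commuting `S_σ` (`σ ∈ ker χ`) act on the eigenlines by characters `ψ_±`, non-vanishing,
multiplicative, with finitely many values and with `ψ_±(σ) = (a ± b d)^{12}` on the Cartan
elements; and reading `J_k S_σ = ∑ᵢ c̄_{ki} S_σ J_i` on `v_+`, the coordinates `x`, `y` of the
`J_k v_+` satisfy `c̄(σ) x = x` and `ψ_-(σ) c̄(σ) y = ψ_+(σ) y`, not both zero as `∑ L_k J_k = 1`.
[folklore] -/
theorem eigen_data_of_matrices {Γ : Type} [Group Γ] {ℓ : ℕ} [Fact ℓ.Prime] (hℓ2 : ℓ ≠ 2)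
    (χ : Γ →* ℤˣ) {D : ZMod ℓ} (hD : D ≠ 0) {r : ℕ} (c : Γ → Matrix (Fin r) (Fin r) (ZMod ℓ))
    (Φ : Matrix (Fin 2) (Fin 2) (ZMod ℓ)) (Sm : Γ → Matrix (Fin 2) (Fin 2) (ZMod ℓ))
    (JM LM : Fin r → Matrix (Fin 2) (Fin 2) (ZMod ℓ))
    (h1 : Φ * Φ = D • (1 : Matrix (Fin 2) (Fin 2) (ZMod ℓ)))
    (h2 : ¬ ∃ e : ZMod ℓ, Φ = e • (1 : Matrix (Fin 2) (Fin 2) (ZMod ℓ)))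
    (h3 : ∀ σ, χ σ = 1 → Sm σ * Φ = Φ * Sm σ)
    (h4 : ∀ σ τ, Sm (σ * τ) = Sm σ * Sm τ) (h5 : Sm 1 = 1)
    (h6 : ∀ σ, χ σ = 1 → ∀ k, JM k * Sm σ = ∑ i, c σ k i • (Sm σ * JM i))
    (h7 : ∑ k, LM k * JM k = 1)
    (h8 : ∀ a b : ZMod ℓ, a ^ 2 - D * b ^ 2 ≠ 0 → ∃ σ : Γ, χ σ = 1 ∧
      Sm σ = (a • (1 : Matrix (Fin 2) (Fin 2) (ZMod ℓ)) + b • Φ) ^ 12) :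
    ∃ (d : AlgebraicClosure (ZMod ℓ)) (ψp ψm : Γ → AlgebraicClosure (ZMod ℓ))
      (x y : Fin r → AlgebraicClosure (ZMod ℓ)),
      d ^ 2 = algebraMap (ZMod ℓ) (AlgebraicClosure (ZMod ℓ)) D ∧ (x ≠ 0 ∨ y ≠ 0) ∧
      (∀ σ, χ σ = 1 → ψp σ ≠ 0 ∧ ψm σ ≠ 0 ∧
        ((c σ).map (algebraMap (ZMod ℓ) (AlgebraicClosure (ZMod ℓ)))) *ᵥ x = x ∧
        ψm σ • (((c σ).map (algebraMap (ZMod ℓ) (AlgebraicClosure (ZMod ℓ)))) *ᵥ y) = ψp σ • y) ∧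
      (∀ σ τ, χ σ = 1 → χ τ = 1 → ψp (σ * τ) = ψp σ * ψp τ ∧ ψm (σ * τ) = ψm σ * ψm τ) ∧
      (Set.range ψp).Finite ∧ (Set.range ψm).Finite ∧
      (∀ a b : ZMod ℓ, a ^ 2 - D * b ^ 2 ≠ 0 → ∃ σ : Γ, χ σ = 1 ∧
        ψp σ = (algebraMap (ZMod ℓ) (AlgebraicClosure (ZMod ℓ)) a +
          algebraMap (ZMod ℓ) (AlgebraicClosure (ZMod ℓ)) b * d) ^ 12 ∧
        ψm σ = (algebraMap (ZMod ℓ) (AlgebraicClosure (ZMod ℓ)) a -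
          algebraMap (ZMod ℓ) (AlgebraicClosure (ZMod ℓ)) b * d) ^ 12) := by
  classical
  have hprime : ℓ.Prime := Fact.out
  -- notation: `F = 𝔽̄_ℓ`, `ι : 𝔽_ℓ → F`, base-changed matrices
  set ι : ZMod ℓ →+* AlgebraicClosure (ZMod ℓ) := algebraMap (ZMod ℓ) (AlgebraicClosure (ZMod ℓ))
    with hι
  haveI : CharP (AlgebraicClosure (ZMod ℓ)) ℓ := charP_of_injective_algebraMap ι.injective ℓ
  have h2F : (2 : AlgebraicClosure (ZMod ℓ)) ≠ 0 := by
    intro h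
    have h' : ((2 : ℕ) : AlgebraicClosure (ZMod ℓ)) = 0 := by exact_mod_cast h
    rw [CharP.cast_eq_zero_iff (AlgebraicClosure (ZMod ℓ)) ℓ] at h'
    exact hℓ2 ((Nat.prime_dvd_prime_iff_eq hprime Nat.prime_two).1 h')
  let mι := ι.mapMatrix (m := Fin 2)
  have hmι : ∀ A : Matrix (Fin 2) (Fin 2) (ZMod ℓ), mι A = A.map ι := fun _ ↦ rfl
  have hmap_smul : ∀ (a : ZMod ℓ) (A : Matrix (Fin 2) (Fin 2) (ZMod ℓ)),
      mι (a • A) = ι a • mι A := fun a A ↦ by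
    ext i j
    simp [hmι, Matrix.map_apply]
  set ΦF := mι Φ with hΦF
  set SF : Γ → Matrix (Fin 2) (Fin 2) (AlgebraicClosure (ZMod ℓ)) := fun σ ↦ mι (Sm σ) with hSF
  set JF : Fin r → Matrix (Fin 2) (Fin 2) (AlgebraicClosure (ZMod ℓ)) := fun k ↦ mι (JM k) with hJF
  set LF : Fin r → Matrix (Fin 2) (Fin 2) (AlgebraicClosure (ZMod ℓ)) := fun k ↦ mι (LM k) with hLF
  have hΦF2 : ΦF * ΦF = ι D • 1 := by rw [hΦF, ← map_mul, h1, hmap_smul, map_one]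
  -- a square root `d` of `D`
  obtain ⟨d, hd⟩ := IsAlgClosed.exists_eq_mul_self (ι D)
  have hd0 : d ≠ 0 := fun h ↦ by
    rw [h, mul_zero, map_eq_zero_iff ι ι.injective] at hd
    exact hD hd
  have h2d : 2 * d ≠ 0 := mul_ne_zero h2F hd0
  -- eigenvectors of `ΦF` for `± d`
  have heig : ∀ e : AlgebraicClosure (ZMod ℓ), e * e = ι D →
      ∃ w : Fin 2 → AlgebraicClosure (ZMod ℓ), w ≠ 0 ∧ ΦF *ᵥ w = e • w := by
    intro e he
    suffices hdet : (ΦF - Matrix.scalar (Fin 2) e).det = 0 by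
      obtain ⟨w, hw, hw'⟩ := Matrix.exists_mulVec_eq_zero_iff.2 hdet
      refine ⟨w, hw, ?_⟩
      rw [Matrix.sub_mulVec, sub_eq_zero] at hw'
      rw [hw']
      funext i
      rw [Matrix.scalar_apply, Matrix.mulVec_diagonal, Pi.smul_apply, smul_eq_mul]
    by_contra hdet
    have hu : IsUnit (ΦF - Matrix.scalar (Fin 2) e) :=
      (Matrix.isUnit_iff_isUnit_det _).2 (isUnit_iff_ne_zero.2 hdet)
    have hprod : (ΦF - Matrix.scalar (Fin 2) e) * (ΦF + Matrix.scalar (Fin 2) e) = 0 := by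
      rw [sub_mul, mul_add, mul_add, hΦF2, Matrix.scalar_apply, ← he]
      ext i j
      simp [Matrix.diagonal, Matrix.mul_apply, Matrix.one_apply]
      ring
    have hzero : ΦF + Matrix.scalar (Fin 2) e = 0 := (hu.mul_right_eq_zero).1 hprod
    -- then `Φ` is the scalar `Φ 0 0`
    apply h2
    refine ⟨Φ 0 0, ?_⟩
    have hentry : ∀ i j, ι (Φ i j) = if i = j then -e else 0 := fun i j ↦ by
      have h := congrFun (congrFun hzero i) j
      simp only [Matrix.add_apply, Matrix.scalar_apply, Matrix.diagonal_apply, Matrix.zero_apply,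
          hΦF,
        hmι, Matrix.map_apply] at h
      split_ifs at h with hij
      · rw [if_pos hij]; linear_combination h
      · rw [if_neg hij]; simpa using h
    ext i j
    rw [Matrix.smul_apply, Matrix.one_apply, smul_eq_mul, mul_ite, mul_one, mul_zero]
    apply ι.injective
    rw [hentry]
    split_ifs with hij
    · rw [hentry, if_pos rfl]
    · rw [map_zero]
  obtain ⟨vp, hvp, hΦp⟩ := heig d hd.symm
  obtain ⟨vm, hvm, hΦm⟩ := heig (-d) (by rw [neg_mul_neg, ← hd])
  -- the eigenbasis `B = (vp, vm)` of `F²`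
  have hli : LinearIndependent (AlgebraicClosure (ZMod ℓ)) ![vp, vm] := by
    rw [LinearIndependent.pair_iff]
    intro s t hst
    have h1 : ΦF *ᵥ (s • vp + t • vm) = 0 := by rw [hst, Matrix.mulVec_zero]
    rw [Matrix.mulVec_add, Matrix.mulVec_smul, Matrix.mulVec_smul, hΦp, hΦm, smul_comm s d,
      smul_comm t (-d), neg_smul, ← sub_eq_add_neg, ← smul_sub] at h1
    have h2 : d • (s • vp + t • vm) + d • (s • vp - t • vm) = 0 :=
        by rw [hst, h1, smul_zero, add_zero]
    rw [smul_add, smul_sub, add_add_sub_cancel, ← two_smul (AlgebraicClosure (ZMod ℓ)), smul_smul,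
      smul_smul] at h2
    have hs : s = 0 := by
      rcases smul_eq_zero.1 h2 with h | h
      · exact (mul_eq_zero.1 h).resolve_left h2d
      · exact absurd h hvp
    rw [hs, zero_smul, zero_add] at hst
    exact ⟨hs, (smul_eq_zero.1 hst).resolve_right hvm⟩
  let B : Module.Basis (Fin 2) (AlgebraicClosure (ZMod ℓ)) (Fin 2 → AlgebraicClosure (ZMod ℓ)) :=
    basisOfLinearIndependentOfCardEqFinrank hli (by simp)
  have hB : ⇑B = ![vp, vm] := coe_basisOfLinearIndependentOfCardEqFinrank _ _
  have hB0 : B 0 = vp := by rw [hB]; rfl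
  have hB1 : B 1 = vm := by rw [hB]; rfl
  have hcoord : ∀ w, w = B.repr w 0 • vp + B.repr w 1 • vm := fun w ↦ by
    conv_lhs => rw [← B.sum_repr w, Fin.sum_univ_two, hB0, hB1]
  have hrepr : ∀ α β : AlgebraicClosure (ZMod ℓ), B.repr (α • vp + β • vm) 0 = α ∧
      B.repr (α • vp + β • vm) 1 = β := fun α β ↦ by
    rw [← hB0, ← hB1, map_add, map_smul, map_smul, B.repr_self, B.repr_self]
    simp
  -- matrices commuting with `ΦF` preserve the eigenlines
  have heigenline : ∀ S : Matrix (Fin 2) (Fin 2) (AlgebraicClosure (ZMod ℓ)), S * ΦF = ΦF * S →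
      S *ᵥ vp = (B.repr (S *ᵥ vp) 0) • vp ∧ S *ᵥ vm = (B.repr (S *ᵥ vm) 1) • vm := by
    intro S hS
    constructor
    · set w := S *ᵥ vp with hw
      have h1 : ΦF *ᵥ w = d • w := by
        rw [hw, Matrix.mulVec_mulVec, ← hS, ← Matrix.mulVec_mulVec, hΦp, Matrix.mulVec_smul]
      have h2 := hcoord w
      rw [h2, Matrix.mulVec_add, Matrix.mulVec_smul, Matrix.mulVec_smul, hΦp, hΦm, smul_add,
          smul_smul,
        smul_smul, smul_smul, smul_smul] at h1
      have h3 := congrArg (fun u ↦ B.repr u 1) h1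
      simp only [(hrepr _ _).2] at h3
      have hβ : B.repr w 1 = 0 := by
        have h4 : (2 * d) * B.repr w 1 = 0 := by linear_combination -h3
        exact (mul_eq_zero.1 h4).resolve_left h2d
      conv_lhs => rw [h2, hβ, zero_smul, add_zero]
    · set w := S *ᵥ vm with hw
      have h1 : ΦF *ᵥ w = (-d) • w := by
        rw [hw, Matrix.mulVec_mulVec, ← hS, ← Matrix.mulVec_mulVec, hΦm, Matrix.mulVec_smul]
      have h2 := hcoord w
      rw [h2, Matrix.mulVec_add, Matrix.mulVec_smul, Matrix.mulVec_smul, hΦp, hΦm, smul_add,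
          smul_smul,
        smul_smul, smul_smul, smul_smul] at h1
      have h3 := congrArg (fun u ↦ B.repr u 0) h1
      simp only [(hrepr _ _).1] at h3
      have hα : B.repr w 0 = 0 := by
        have h4 : (2 * d) * B.repr w 0 = 0 := by linear_combination h3
        exact (mul_eq_zero.1 h4).resolve_left h2d
      conv_lhs => rw [h2, hα, zero_smul, zero_add]
  -- the characters `ψ±` and the coordinates `x`, `y` of `J_k vp`
  let ψp : Γ → AlgebraicClosure (ZMod ℓ) := fun σ ↦ B.repr (SF σ *ᵥ vp) 0
  let ψm : Γ → AlgebraicClosure (ZMod ℓ) := fun σ ↦ B.repr (SF σ *ᵥ vm) 1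
  let x : Fin r → AlgebraicClosure (ZMod ℓ) := fun k ↦ B.repr (JF k *ᵥ vp) 0
  let y : Fin r → AlgebraicClosure (ZMod ℓ) := fun k ↦ B.repr (JF k *ᵥ vp) 1
  have hSF_comm : ∀ σ, χ σ = 1 → SF σ * ΦF = ΦF * SF σ := fun σ hσ ↦ by
    rw [hSF, hΦF]
    change mι (Sm σ) * mι Φ = mι Φ * mι (Sm σ)
    rw [← map_mul, ← map_mul, h3 σ hσ]
  have hSp : ∀ σ, χ σ = 1 → SF σ *ᵥ vp = ψp σ • vp := fun σ hσ ↦ (heigenline _ (hSF_comm σ hσ)).1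
  have hSm' : ∀ σ, χ σ = 1 → SF σ *ᵥ vm = ψm σ • vm := fun σ hσ ↦ (heigenline _ (hSF_comm σ hσ)).2
  have hSF_mul : ∀ σ τ, SF (σ * τ) = SF σ * SF τ := fun σ τ ↦ by
    rw [hSF]; change mι (Sm (σ * τ)) = mι (Sm σ) * mι (Sm τ); rw [← map_mul, h4]
  have hSF_one : SF 1 = 1 := by rw [hSF]; change mι (Sm 1) = 1; rw [h5, map_one]
  have hJ : ∀ k, JF k *ᵥ vp = x k • vp + y k • vm := fun k ↦ hcoord _
  have hχinv : ∀ σ, χ σ = 1 → χ σ⁻¹ = 1 := fun σ hσ ↦ by rw [map_inv, hσ, inv_one]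
  -- non-vanishing of `ψ±` on `Γ_K`
  have hψ0 : ∀ σ, χ σ = 1 → ψp σ ≠ 0 ∧ ψm σ ≠ 0 := by
    intro σ hσ
    have hinv : SF σ⁻¹ * SF σ = 1 := by rw [← hSF_mul, inv_mul_cancel, hSF_one]
    constructor
    · intro h
      apply hvp
      have h1 := hSp σ hσ
      rw [h, zero_smul] at h1
      rw [← Matrix.one_mulVec vp, ← hinv, ← Matrix.mulVec_mulVec, h1, Matrix.mulVec_zero]
    · intro h
      apply hvm
      have h1 := hSm' σ hσ
      rw [h, zero_smul] at h1
      rw [← Matrix.one_mulVec vm, ← hinv, ← Matrix.mulVec_mulVec, h1, Matrix.mulVec_zero]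
  refine ⟨d, ψp, ψm, x, y, by rw [sq, ← hd], ?_, ?_, ?_, ?_, ?_, ?_⟩
  · -- `(x, y) ≠ 0`: `∑ L_k J_k = 1` and `vp ≠ 0`
    by_contra hxy
    push Not at hxy
    obtain ⟨hx, hy⟩ := hxy
    apply hvp
    have h0 : ∀ k, JF k *ᵥ vp = 0 := fun k ↦ by
      rw [hJ, show x k = 0 from congrFun hx k, show y k = 0 from congrFun hy k, zero_smul,
          zero_smul,
        add_zero]
    have h7F : ∑ k, LF k * JF k = 1 := by
      rw [hLF, hJF]
      change ∑ k, mι (LM k) * mι (JM k) = 1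
      simp_rw [← map_mul]
      rw [← map_sum, h7, map_one]
    calc vp = (∑ k, LF k * JF k) *ᵥ vp := by rw [h7F, Matrix.one_mulVec]
      _ = ∑ k, LF k *ᵥ (JF k *ᵥ vp) := by
          change Matrix.mulVec.addMonoidHomLeft vp (∑ k, LF k * JF k) = _
          rw [map_sum]
          refine Finset.sum_congr rfl fun k _ ↦ ?_
          change (LF k * JF k) *ᵥ vp = _
          rw [Matrix.mulVec_mulVec]
      _ = 0 := by simp [h0]
  · -- the equivariance read on `vp`
    intro σ hσ
    refine ⟨(hψ0 σ hσ).1, (hψ0 σ hσ).2, ?_, ?_⟩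
    · funext k
      have h := congrArg (fun S : Matrix (Fin 2) (Fin 2) (AlgebraicClosure (ZMod ℓ)) ↦ B.repr (S *ᵥ
          vp) 0)
        (show JF k * SF σ = ∑ i, ι (c σ k i) • (SF σ * JF i) by
          rw [hJF, hSF]
          change mι (JM k) * mι (Sm σ) = ∑ i, ι (c σ k i) • (mι (Sm σ) * mι (JM i))
          rw [← map_mul, h6 σ hσ k, map_sum]
          refine Finset.sum_congr rfl fun i _ ↦ ?_
          rw [hmap_smul, map_mul])
      rw [← Matrix.mulVec_mulVec, hSp σ hσ, Matrix.mulVec_smul, hJ, smul_add, smul_smul, smul_smul,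
        (hrepr _ _).1] at h
      have hsum : (∑ i, ι (c σ k i) • (SF σ * JF i)) *ᵥ vp =
          (∑ i, ι (c σ k i) * (x i * ψp σ)) • vp + (∑ i, ι (c σ k i) * (y i * ψm σ)) • vm := by
        change Matrix.mulVec.addMonoidHomLeft vp _ = _
        rw [map_sum, Finset.sum_smul, Finset.sum_smul, ← Finset.sum_add_distrib]
        refine Finset.sum_congr rfl fun i _ ↦ ?_
        change (ι (c σ k i) • (SF σ * JF i)) *ᵥ vp = _
        rw [Matrix.smul_mulVec, ← Matrix.mulVec_mulVec, hJ, Matrix.mulVec_add, Matrix.mulVec_smul,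
          Matrix.mulVec_smul, hSp σ hσ, hSm' σ hσ, smul_add, smul_smul, smul_smul, smul_smul,
              smul_smul,
          mul_assoc, mul_assoc]
      rw [hsum, (hrepr _ _).1] at h
      -- `h : ψp σ * x k = ∑ i, ι (c σ k i) * (x i * ψp σ)`
      have h' : ψp σ * x k = ψp σ * ((c σ).map ι *ᵥ x) k := by
        rw [h, Matrix.mulVec, dotProduct, Finset.mul_sum]
        refine Finset.sum_congr rfl fun i _ ↦ ?_
        rw [Matrix.map_apply]; ring
      exact (mul_left_cancel₀ (hψ0 σ hσ).1 h').symm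
    · funext k
      have h := congrArg (fun S : Matrix (Fin 2) (Fin 2) (AlgebraicClosure (ZMod ℓ)) ↦ B.repr (S *ᵥ
          vp) 1)
        (show JF k * SF σ = ∑ i, ι (c σ k i) • (SF σ * JF i) by
          rw [hJF, hSF]
          change mι (JM k) * mι (Sm σ) = ∑ i, ι (c σ k i) • (mι (Sm σ) * mι (JM i))
          rw [← map_mul, h6 σ hσ k, map_sum]
          refine Finset.sum_congr rfl fun i _ ↦ ?_
          rw [hmap_smul, map_mul])
      rw [← Matrix.mulVec_mulVec, hSp σ hσ, Matrix.mulVec_smul, hJ, smul_add, smul_smul, smul_smul,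
        (hrepr _ _).2] at h
      have hsum : (∑ i, ι (c σ k i) • (SF σ * JF i)) *ᵥ vp =
          (∑ i, ι (c σ k i) * (x i * ψp σ)) • vp + (∑ i, ι (c σ k i) * (y i * ψm σ)) • vm := by
        change Matrix.mulVec.addMonoidHomLeft vp _ = _
        rw [map_sum, Finset.sum_smul, Finset.sum_smul, ← Finset.sum_add_distrib]
        refine Finset.sum_congr rfl fun i _ ↦ ?_
        change (ι (c σ k i) • (SF σ * JF i)) *ᵥ vp = _
        rw [Matrix.smul_mulVec, ← Matrix.mulVec_mulVec, hJ, Matrix.mulVec_add, Matrix.mulVec_smul,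
          Matrix.mulVec_smul, hSp σ hσ, hSm' σ hσ, smul_add, smul_smul, smul_smul, smul_smul,
              smul_smul,
          mul_assoc, mul_assoc]
      rw [hsum, (hrepr _ _).2] at h
      -- `h : ψp σ * y k = ∑ i, ι (c σ k i) * (y i * ψm σ)`
      rw [Pi.smul_apply, Pi.smul_apply, smul_eq_mul, smul_eq_mul, mul_comm (ψp σ) (y k)]
      rw [mul_comm] at h
      rw [h, Matrix.mulVec, dotProduct, Finset.mul_sum]
      refine Finset.sum_congr rfl fun i _ ↦ ?_
      rw [Matrix.map_apply]; ring
  · -- multiplicativity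
    intro σ τ hσ hτ
    have hστ : χ (σ * τ) = 1 := by rw [map_mul, hσ, hτ, mul_one]
    constructor
    · apply smul_left_injective (AlgebraicClosure (ZMod ℓ)) hvp
      change ψp (σ * τ) • vp = (ψp σ * ψp τ) • vp
      rw [← hSp _ hστ, hSF_mul, ← Matrix.mulVec_mulVec, hSp τ hτ, Matrix.mulVec_smul, hSp σ hσ,
          smul_smul,
        mul_comm]
    · apply smul_left_injective (AlgebraicClosure (ZMod ℓ)) hvm
      change ψm (σ * τ) • vm = (ψm σ * ψm τ) • vm
      rw [← hSm' _ hστ, hSF_mul, ← Matrix.mulVec_mulVec, hSm' τ hτ, Matrix.mulVec_smul, hSm' σ hσ,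
          smul_smul,
        mul_comm]
  · refine (Set.finite_range (fun A : Matrix (Fin 2) (Fin 2) (ZMod ℓ) ↦ B.repr ((mι A) *ᵥ vp)
      0)).subset ?_
    rintro _ ⟨σ, rfl⟩
    exact ⟨Sm σ, rfl⟩
  · refine (Set.finite_range (fun A : Matrix (Fin 2) (Fin 2) (ZMod ℓ) ↦ B.repr ((mι A) *ᵥ vm)
      1)).subset ?_
    rintro _ ⟨σ, rfl⟩
    exact ⟨Sm σ, rfl⟩
  · -- the Cartan values
    intro a b hab
    obtain ⟨σ, hσ1, hσ⟩ := h8 a b hab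
    refine ⟨σ, hσ1, ?_, ?_⟩
    · have hpow : ∀ n : ℕ, ((ι a • (1 : Matrix (Fin 2) (Fin 2) (AlgebraicClosure (ZMod ℓ))) + ι b •
        ΦF) ^ n)
          *ᵥ vp = (ι a + ι b * d) ^ n • vp := by
        intro n
        induction n with
        | zero => rw [pow_zero, pow_zero, Matrix.one_mulVec, one_smul]
        | succ n ih =>
          rw [pow_succ, ← Matrix.mulVec_mulVec, Matrix.add_mulVec, Matrix.smul_mulVec,
              Matrix.smul_mulVec,
            Matrix.one_mulVec, hΦp, smul_smul, ← add_smul, Matrix.mulVec_smul, ih, smul_smul,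
                pow_succ]
          congr 1
          ring
      apply smul_left_injective (AlgebraicClosure (ZMod ℓ)) hvp
      change ψp σ • vp = (ι a + ι b * d) ^ 12 • vp
      rw [← hSp σ hσ1, ← hpow, hSF]
      change mι (Sm σ) *ᵥ vp = _
      rw [hσ, map_pow, map_add, hmap_smul, hmap_smul, map_one]
    · have hpow : ∀ n : ℕ, ((ι a • (1 : Matrix (Fin 2) (Fin 2) (AlgebraicClosure (ZMod ℓ))) + ι b •
        ΦF) ^ n)
          *ᵥ vm = (ι a - ι b * d) ^ n • vm := by
        intro n
        induction n with
        | zero => rw [pow_zero, pow_zero, Matrix.one_mulVec, one_smul]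
        | succ n ih =>
          rw [pow_succ, ← Matrix.mulVec_mulVec, Matrix.add_mulVec, Matrix.smul_mulVec,
              Matrix.smul_mulVec,
            Matrix.one_mulVec, hΦm, smul_smul, ← add_smul, Matrix.mulVec_smul, ih, smul_smul,
                pow_succ]
          congr 1
          ring
      apply smul_left_injective (AlgebraicClosure (ZMod ℓ)) hvm
      change ψm σ • vm = (ι a - ι b * d) ^ 12 • vm
      rw [← hSm' σ hσ1, ← hpow, hSF]
      change mι (Sm σ) *ᵥ vm = _
      rw [hσ, map_pow, map_add, hmap_smul, hmap_smul, map_one]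

end Summit.ABC.ABC.Theorems.IsotypicMinkowski

end
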